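import Literature.Probability.Percolation.ZdFourArmQuasiMult
import Literature.Probability.Percolation.ZdEdgeFourArmRerooting
import Literature.Probability.Percolation.DeletionTolerance
import HarnessLib

/-!
# Quasi-multiplicativity of the four-arm probability from a single bond: reduction to annuli

Topic `Literature/Probability/Percolation`; PROOFS ONLY (no definition, no named fact).
Companion of `ZdFourArmQuasiMult.lean`, bond percolation on `ℤ²` at `p = 1/2`
(`P = bondPercolation (zdGraph 2) half`); sibling of `ZdFourArmQuasiMultProofs.lean` (which
reduces the ANNULUS quasi-multiplicativity fact to its well-spaced case).

The named fact `Nolin2008_zdEdgeFourArmQuasiMult` (P. Nolin, *Near-critical percolation in two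
dimensions*, EJP 13 (2008), Prop. 17 [arXiv 0711.4948: Prop. 16] with `n₁ = n₀(4) = 0`, §8.1;
C. Garban, G. Pete, O. Schramm, JAMS 26 (2013), §2.1; originally H. Kesten, CMP 109 (1987)) is
the LOWER (hard) quasi-multiplicativity inequality with the inner annulus shrunk to the bond
`e = s(0, e₀)`:

  `c · P(edgeFourArm [-m,m]² 0 0) · P(fourArmTwoClusters m N) ≤ P(edgeFourArm [-N,N]² 0 0)`.

Nolin, §4.1: "for any fixed `n₁, n₂ ≥ n₀(j)`, `P̂(A_{j,σ}(n₁,N)) ≍ P̂(A_{j,σ}(n₂,N))`" — the inner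
radius (here: arms from the bond versus arms from the sup-norm sphere of radius `1`) is
immaterial, by a local modification near the origin. This file PROVES that remark for the
tree's two cluster-form events and thereby REDUCES the fact to the annulus quasi-multiplicativity
`DuminilCopinManolescuTassion2021_zdFourArm_quasiMult` (same file; Duminil-Copin–Manolescu–Tassion
2021, Prop. 6.3 at `q = 1`, upper inequality) taken at inner radius `r = 1`:

* `bondPercolation_real_le_of_localModification` — **uniform finite energy with a window**: if
  every lattice configuration of `A` can be moved into the measurable event `E` by re-setting
  the edges of a fixed finite window `F`, then `(p(1-p))^{|F|} P_p(A) ≤ 2^{|F|} P_p(E)`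
  (Grimmett 1999, §2 / Kesten 1987, §2: "connections inside a fixed box can be rearranged at
  bounded cost"; assembled from the tree's insertion and deletion tolerance);
* `measurableSet_edgeFourArm_box` — the edge four-arm event in a box is a cylinder event;
* `real_edgeFourArm_box_le_real_fourArmTwoClusters_one` — `P(edgeFourArm [-m,m]² 0 0) ≤
  P(fourArmTwoClusters 1 m)` (`m ≥ 1`): the tree's first-exit surgery
  `relabel_mem_fourArmTwoClusters_of_arms` (`ZdPivotalFourArm.lean`) and translation invariance;
* `exists_rerooting_of_mem_fourArmTwoClusters_one`, `real_fourArmTwoClusters_one_le` —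
  `P(fourArmTwoClusters 1 N) ≤ 8^{|window|} · P(edgeFourArm [-N,N]² 0 0)` (`N ≥ 2`): the
  re-rooting surgery of `ZdEdgeFourArmRerooting.lean` inside the window of edges meeting
  `[-1,1]²`;
* `Nolin2008_zdEdgeFourArmQuasiMult_of_zdFourArm_quasiMult` — **the reduction**:
  `DuminilCopinManolescuTassion2021_zdFourArm_quasiMult → Nolin2008_zdEdgeFourArmQuasiMult`,
  with `N₀ = 2` and `c = 1 / (C · 8^{|window|})`.

What is NOT here: a proof of the annulus quasi-multiplicativity itself (Kesten's arm-separation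
theory for bond percolation on `ℤ²`, Nolin 2008 Thm. 11 / Prop. 12 — the tree has it for site
percolation on `𝕋` only, `ArmSeparation*.lean`).

## References

* P. Nolin, EJP 13 (2008), §4.1 (inner radius), Prop. 17 [arXiv: Prop. 16] [Nolin2008].
* H. Kesten, Comm. Math. Phys. 109 (1987), §2 [KestenScalingCMP1987].
* C. Garban, G. Pete, O. Schramm, JAMS 26 (2013), §2.1 [GarbanPeteSchramm2013Pivotal].
* H. Duminil-Copin, I. Manolescu, V. Tassion, PTRF 181 (2021), Prop. 6.3
  [DuminilCopinManolescuTassion2021].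
* G. Grimmett, *Percolation* (1999), §2.2 (cylinder events), §1.3 (product measure) [Grimmett1999].
-/

noncomputable section

namespace Literature.Probability.Percolation

open Set LatticeModels
open _root_.MeasureTheory

/-! ### Uniform finite energy with a prescribed window -/

section LocalModification

variable {V : Type*} [Countable V]

/-- **Local modification inside a fixed window costs a bounded factor.** Let `F` be a finite set
of edges of `G` and `E` a measurable event. If every lattice configuration `ω ∈ A` can be moved
into `E` by closing all edges of `F` and re-opening some subset `σ ⊆ F` (depending on `ω`), then
`(p (1 - p))^{|F|} · P_p(A) ≤ 2^{|F|} · P_p(E)`: for each of the `2^{|F|}` patterns `σ`, deletion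
tolerance (`(1-p)^{|F|}`) followed by insertion tolerance (`p^{|σ|} ≥ p^{|F|}`) bounds the
probability of `{ω | (ω ∖ F) ∪ σ ∈ E}` by `(p(1-p))^{-|F|} P_p(E)`. (Grimmett 1999, §1.3, product
measure; Kesten 1987, §2, rearranging connections in a fixed box.) [folklore] -/
theorem bondPercolation_real_le_of_localModification (G : SimpleGraph V) (p : unitInterval)
    (F : Finset (Sym2 V)) (hF : (↑F : Set (Sym2 V)) ⊆ G.edgeSet) {A E : Set (BondConfig V)}
    (hE : MeasurableSet E)
    (h : ∀ ω ∈ A, ω ⊆ G.edgeSet → ∃ σ : Finset (Sym2 V), σ ⊆ F ∧ (ω \ ↑F) ∪ ↑σ ∈ E) :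
    ((p : ℝ) * (1 - p)) ^ F.card * (bondPercolation G p).real A ≤
      2 ^ F.card * (bondPercolation G p).real E := by
  classical
  set P := bondPercolation G p with hP
  have hp0 : 0 ≤ (p : ℝ) := p.2.1
  have hp1 : (p : ℝ) ≤ 1 := p.2.2
  -- the event reached through the pattern `σ`
  set Ev : Finset (Sym2 V) → Set (BondConfig V) :=
    fun σ => closeEdges (↑F : Set (Sym2 V)) ⁻¹' (openEdges (↑σ : Set (Sym2 V)) ⁻¹' E) with hEv
  have hbound : ∀ σ ∈ F.powerset, ((p : ℝ) * (1 - p)) ^ F.card * P.real (Ev σ) ≤ P.real E := by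
    intro σ hσ
    rw [Finset.mem_powerset] at hσ
    have hσE : (↑σ : Set (Sym2 V)) ⊆ G.edgeSet := (Finset.coe_subset.2 hσ).trans hF
    have h1 := bondPercolation_pow_mul_real_preimage_closeEdges_le G p F
      (measurable_openEdges (↑σ : Set (Sym2 V)) hE)
    have h2 := bondPercolation_pow_mul_real_preimage_openEdges_le G p σ hσE hE
    have h3 : (p : ℝ) ^ F.card ≤ (p : ℝ) ^ σ.card :=
      pow_le_pow_of_le_one hp0 hp1 (Finset.card_le_card hσ)
    have h4 : 0 ≤ P.real (openEdges (↑σ : Set (Sym2 V)) ⁻¹' E) := measureReal_nonneg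
    calc ((p : ℝ) * (1 - p)) ^ F.card * P.real (Ev σ)
        = (p : ℝ) ^ F.card * ((1 - (p : ℝ)) ^ F.card * P.real (Ev σ)) := by rw [mul_pow]; ring
      _ ≤ (p : ℝ) ^ σ.card * P.real (openEdges (↑σ : Set (Sym2 V)) ⁻¹' E) :=
          mul_le_mul h3 h1 (mul_nonneg (pow_nonneg (by linarith) _) measureReal_nonneg)
            (pow_nonneg hp0 _)
      _ ≤ P.real E := h2
  -- `A` is a.s. covered by the `2^{|F|}` events
  have hae : A ≤ᵐ[P] (⋃ σ ∈ F.powerset, Ev σ : Set (BondConfig V)) := by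
    filter_upwards [ae_subset_edgeSet G p] with ω hω hA
    obtain ⟨σ, hσ, hmem⟩ := h ω hA hω
    refine mem_iUnion₂.2 ⟨σ, Finset.mem_powerset.2 hσ, ?_⟩
    simpa only [hEv, mem_preimage, openEdges, closeEdges] using hmem
  calc ((p : ℝ) * (1 - p)) ^ F.card * P.real A
      ≤ ((p : ℝ) * (1 - p)) ^ F.card * P.real (⋃ σ ∈ F.powerset, Ev σ) :=
        mul_le_mul_of_nonneg_left
          (ENNReal.toReal_mono (measure_ne_top _ _) (measure_mono_ae hae))
          (pow_nonneg (mul_nonneg hp0 (by linarith)) _)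
    _ ≤ ((p : ℝ) * (1 - p)) ^ F.card * ∑ σ ∈ F.powerset, P.real (Ev σ) :=
        mul_le_mul_of_nonneg_left (measureReal_biUnion_finset_le _ _)
          (pow_nonneg (mul_nonneg hp0 (by linarith)) _)
    _ = ∑ σ ∈ F.powerset, ((p : ℝ) * (1 - p)) ^ F.card * P.real (Ev σ) := Finset.mul_sum _ _ _
    _ ≤ ∑ σ ∈ F.powerset, P.real E := Finset.sum_le_sum hbound
    _ = 2 ^ F.card * P.real E := by rw [Finset.sum_const, nsmul_eq_mul, Finset.card_powerset]; push_cast; ring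

end LocalModification

/-! ### The edge four-arm event in a box is a cylinder event -/

/-- The edge four-arm event inside the box `[-N,N]²` is determined by the pairs of sites of the
box, hence measurable (Grimmett 1999, §2.2, cylinder events). [folklore] -/
theorem measurableSet_edgeFourArm_box (N : ℕ) (x : Site 2) (i : Fin 2) :
    MeasurableSet (edgeFourArm (↑(box 2 N) : Set (Site 2)) x i) := by
  refine DeterminedBy.measurableSet_of_finset (F := (box 2 N).sym2) ?_
  rw [determinedBy_iff]
  intro ω ω' h
  have h' : (ω \ {edgeFrom x i}) ∩ ↑((box 2 N).sym2) = (ω' \ {edgeFrom x i}) ∩ ↑((box 2 N).sym2) := by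
    ext f
    have := Set.ext_iff.1 h f
    simp only [mem_inter_iff, Set.mem_sdiff, mem_singleton_iff] at this ⊢
    tauto
  have key := fun a b =>
    (determinedBy_iff _ _).1 (PlanarDuality.determinedBy_openConnIn (box 2 N) a b) _ _ h'
  simp only [edgeFourArm, mem_setOf_eq, key]

/-! ### Four arms from the bond give four arms from radius `1` -/

/-- A boundary site of `[-m,m]²` is not in `[-(m-1), m-1]²` (`m ≥ 1`). [folklore] -/
theorem sub_zero_notMem_box_of_mem_vertexBoundary {m : ℕ} (hm : 1 ≤ m) {u : Site 2}
    (hu : u ∈ vertexBoundary (↑(box 2 m) : Set (Site 2))) : u - 0 ∉ box 2 (m - 1) := by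
  intro hbox
  obtain ⟨-, w, hw, hadj⟩ := hu
  have := ZdPivotal.sub_mem_box_succ_of_adj hbox hadj
  rw [Nat.sub_add_cancel hm, sub_zero] at this
  exact hw (Finset.mem_coe.2 this)

/-- **Four arms from the bond `s(0, e₀)` to `∂[-m,m]²` contain four arms across `A_{1,m}`**
(`m ≥ 1`): `P(edgeFourArm [-m,m]² 0 0) ≤ P(fourArmTwoClusters 1 m)` — the first-exit surgery
`relabel_mem_fourArmTwoClusters_of_arms` of `ZdPivotalFourArm.lean` at the origin, and translation
invariance of `P_{1/2}` (Nolin 2008, §4.1: the inner radius is immaterial, trivial direction).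
[folklore] -/
theorem real_edgeFourArm_box_le_real_fourArmTwoClusters_one {m : ℕ} (hm : 1 ≤ m) :
    (bondPercolation (zdGraph 2) half).real (edgeFourArm (↑(box 2 m) : Set (Site 2)) 0 0) ≤
      (bondPercolation (zdGraph 2) half).real (fourArmTwoClusters 1 m) := by
  set P := bondPercolation (zdGraph 2) half with hP
  have hS : ∀ x : Site 2, x - 0 ∈ box 2 m → x ∈ (↑(box 2 m) : Set (Site 2)) := fun x hx => by
    rw [sub_zero] at hx
    exact Finset.mem_coe.2 hx
  have hsub : edgeFourArm (↑(box 2 m) : Set (Site 2)) 0 0 ∩ {ω | ω ⊆ (zdGraph 2).edgeSet} ⊆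
      BondConfig.relabel (sym2Equiv (Site.shift (-(0 : Site 2)))) ⁻¹' fourArmTwoClusters 1 m := by
    rintro ω ⟨⟨⟨u, hu, h1⟩, ⟨u', hu', h2⟩, h3⟩, hω⟩
    have h3' : ω \ {edgeFrom (0 : Site 2) 0} ∉ openConnIn (↑(box 2 m) : Set (Site 2)) 0 u' :=
      fun hc => by
        rw [openConnIn_comm] at h2
        exact h3 (PlanarDuality.openConnIn_trans hc h2)
    exact relabel_mem_fourArmTwoClusters_of_arms hω ((zdGraph_adj_iff _ _).2 ⟨0, Or.inl rfl⟩) hm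
      hS (sub_zero_notMem_box_of_mem_vertexBoundary hm hu) h1
      (sub_zero_notMem_box_of_mem_vertexBoundary hm hu') h2 h3'
  have hae : (edgeFourArm (↑(box 2 m) : Set (Site 2)) 0 0 : Set (BondConfig (Site 2))) ≤ᵐ[P]
      (BondConfig.relabel (sym2Equiv (Site.shift (-(0 : Site 2)))) ⁻¹' fourArmTwoClusters 1 m :
        Set (BondConfig (Site 2))) := by
    filter_upwards [ae_subset_edgeSet (zdGraph 2) half] with ω hω h
    exact hsub ⟨h, hω⟩
  calc P.real (edgeFourArm (↑(box 2 m) : Set (Site 2)) 0 0)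
      ≤ P.real (BondConfig.relabel (sym2Equiv (Site.shift (-(0 : Site 2)))) ⁻¹'
          fourArmTwoClusters 1 m) :=
        ENNReal.toReal_mono (measure_ne_top _ _) (measure_mono_ae hae)
    _ = P.real (fourArmTwoClusters 1 m) := bondPercolation_real_preimage_shift _ _ _

/-! ### Four arms from radius `1` re-rooted at the bond -/

/-- **Every lattice configuration of `fourArmTwoClusters 1 N` can be re-rooted at the bond
`s(0, e₀)` inside the window** (`N ≥ 2`): there is a set `σ` of window edges with
`(ω ∖ window) ∪ σ ∈ edgeFourArm [-N,N]² 0 0`. Proof: walk the two annulus arms inwards from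
`∂[-N,N]²` to their first entrance into `[-1,1]²` (`exists_prefix_exit`); the parts off `[-1,1]²`
are not joined off `[-1,1]²` (else the two arms would lie in one annulus cluster), the entrance
sites are distinct sites of the unit sup-norm sphere, and `exists_disjoint_rootingWalks` /
`exists_rerooting` (`ZdEdgeFourArmRerooting.lean`) do the rest. [folklore] -/
theorem exists_rerooting_of_mem_fourArmTwoClusters_one {N : ℕ} (hN : 2 ≤ N)
    {ω : BondConfig (Site 2)} (hω : ω ⊆ (zdGraph 2).edgeSet) (h : ω ∈ fourArmTwoClusters 1 N) :
    ∃ σ : Finset (Sym2 (Site 2)), σ ⊆ edgesNearOrigin ∧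
      (ω \ ↑edgesNearOrigin) ∪ ↑σ ∈ edgeFourArm (↑(box 2 N) : Set (Site 2)) 0 0 := by
  classical
  obtain ⟨x₁, hx₁, x₂, hx₂, y₁, hy₁, y₂, hy₂, h₁, h₂, h₁₂⟩ := h
  have hA : sqAnnulus 1 N = (↑(annulus 2 0 N) : Set (Site 2)) := rfl
  rw [hA] at h₁ h₂ h₁₂
  have hN1 : 1 ≤ N := by omega
  -- geometry of the spheres
  have hsphN : ∀ {y : Site 2}, y ∈ siteSphere N → y ∉ box 2 1 := fun {y} hy hy1 =>
    (Finset.mem_sdiff.1 hy).2 (box_mono 2 (by omega) hy1)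
  have hsph1 : ∀ {x : Site 2}, x ∈ siteSphere 1 → x ∈ box 2 1 := fun {x} hx =>
    (Finset.mem_sdiff.1 hx).1
  have hannN : ∀ {v : Site 2}, v ∈ (↑(annulus 2 0 N) : Set (Site 2)) → v ∈ box 2 N := fun {v} hv =>
    (Finset.mem_sdiff.1 (Finset.mem_coe.1 hv)).1
  have hann1 : ∀ {v : Site 2}, v ∈ (↑(annulus 2 0 N) : Set (Site 2)) → v ∈ box 2 1 →
      v ∈ siteSphere 1 := fun {v} hv hv1 =>
    Finset.mem_sdiff.2 ⟨hv1, (Finset.mem_sdiff.1 (Finset.mem_coe.1 hv)).2⟩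
  have hA'A : ((↑(box 2 N) : Set (Site 2)) \ ↑(box 2 1)) ⊆ ↑(annulus 2 0 N) := fun v hv =>
    Finset.mem_coe.2 (Finset.mem_sdiff.2 ⟨Finset.mem_coe.1 hv.1,
      fun h0 => hv.2 (Finset.mem_coe.2 (box_mono 2 zero_le_one h0))⟩)
  -- the two arms as lattice walks, and their first entrances into `[-1,1]²`
  obtain ⟨P₁, hP₁A, hP₁ω⟩ := exists_walk_of_mem_openConnIn hω h₁
  obtain ⟨P₂, hP₂A, hP₂ω⟩ := exists_walk_of_mem_openConnIn hω h₂
  obtain ⟨w₁, z₁, q₁, hwz₁, hz₁, hq₁I, hq₁P, hq₁E, hlast₁⟩ :=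
    exists_prefix_exit (A := {v : Site 2 | v ∉ box 2 1}) P₁.reverse (hsphN hy₁)
      (fun h => h (hsph1 hx₁))
  obtain ⟨w₂, z₂, q₂, hwz₂, hz₂, hq₂I, hq₂P, hq₂E, hlast₂⟩ :=
    exists_prefix_exit (A := {v : Site 2 | v ∉ box 2 1}) P₂.reverse (hsphN hy₂)
      (fun h => h (hsph1 hx₂))
  simp only [mem_setOf_eq, not_not] at hz₁ hz₂
  rw [SimpleGraph.Walk.edges_reverse, List.mem_reverse] at hlast₁ hlast₂
  have hq₁N : ∀ v ∈ q₁.support, v ∈ box 2 N := fun v hv =>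
    hannN (hP₁A v (by simpa using hq₁P v hv))
  have hq₂N : ∀ v ∈ q₂.support, v ∈ box 2 N := fun v hv =>
    hannN (hP₂A v (by simpa using hq₂P v hv))
  have hq₁ω : ∀ e ∈ q₁.edges, e ∈ ω := fun e he => hP₁ω e (by simpa using hq₁E e he)
  have hq₂ω : ∀ e ∈ q₂.edges, e ∈ ω := fun e he => hP₂ω e (by simpa using hq₂E e he)
  -- positions: `zᵢ` on the unit sphere, `wᵢ` on the arms
  have hz₁P : z₁ ∈ P₁.support := P₁.snd_mem_support_of_mem_edges hlast₁
  have hz₂P : z₂ ∈ P₂.support := P₂.snd_mem_support_of_mem_edges hlast₂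
  have hw₁P : w₁ ∈ P₁.support := P₁.fst_mem_support_of_mem_edges hlast₁
  have hw₂P : w₂ ∈ P₂.support := P₂.fst_mem_support_of_mem_edges hlast₂
  have hz₁s : z₁ ∈ siteSphere 1 := hann1 (hP₁A z₁ hz₁P) hz₁
  have hz₂s : z₂ ∈ siteSphere 1 := hann1 (hP₂A z₂ hz₂P) hz₂
  -- anything on the first arm is joined to `x₁` inside the annulus, and similarly for the second
  have hj₁ : ∀ {v}, v ∈ P₁.support → ω ∈ openConnIn (↑(annulus 2 0 N) : Set (Site 2)) x₁ v :=
    fun hv => mem_openConnIn_of_mem_support P₁ hP₁A hP₁ω hv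
  have hj₂ : ∀ {v}, v ∈ P₂.support → ω ∈ openConnIn (↑(annulus 2 0 N) : Set (Site 2)) v x₂ :=
    fun hv => by rw [openConnIn_comm]; exact mem_openConnIn_of_mem_support P₂ hP₂A hP₂ω hv
  have hsep : ω ∉ openConnIn ((↑(box 2 N) : Set (Site 2)) \ ↑(box 2 1)) w₁ w₂ := fun hc =>
    h₁₂ (PlanarDuality.openConnIn_trans (PlanarDuality.openConnIn_trans (hj₁ hw₁P)
      (openConnIn_mono hA'A _ _ hc)) (hj₂ hw₂P))
  have hsep' : ω ∉ openConnIn ((↑(box 2 N) : Set (Site 2)) \ ↑(box 2 1)) w₂ w₁ := by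
    rwa [openConnIn_comm]
  have hzne : z₁ ≠ z₂ := fun heq =>
    h₁₂ (PlanarDuality.openConnIn_trans (hj₁ hz₁P) (heq ▸ hj₂ hz₂P))
  -- boundary sites
  have hy₁b := mem_vertexBoundary_box_of_mem_siteSphere hN1 hy₁
  have hy₂b := mem_vertexBoundary_box_of_mem_siteSphere hN1 hy₂
  -- ring indices and rooting walks
  obtain ⟨k₁, hk₁, rfl⟩ := exists_unitRingPt_eq hz₁s
  obtain ⟨k₂, hk₂, rfl⟩ := exists_unitRingPt_eq hz₂s
  have hkne : k₁ ≠ k₂ := fun h => hzne (h ▸ rfl)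
  obtain ⟨a, b, hab, Q₁, Q₂, hQ₁, hQ₂, hdisj⟩ := exists_disjoint_rootingWalks hk₁ hk₂ hkne
  set Q₂' : (zdGraph 2).Walk ((0 : Site 2) + Pi.single 0 1) (unitRingPt b) :=
    Q₂.copy unitRingPt_zero rfl with hQ₂'
  have hQ₂'s : ∀ v ∈ Q₂'.support, v ∈ box 2 1 := fun v hv => hQ₂ v (by simpa [hQ₂'] using hv)
  have hdisj' : ∀ v ∈ Q₁.support, v ∉ Q₂'.support := fun v hv hv' =>
    hdisj v hv (by simpa [hQ₂'] using hv')
  rcases hab with ⟨rfl, rfl⟩ | ⟨rfl, rfl⟩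
  · exact exists_rerooting hN1 hω hy₁b hy₂b q₁ hq₁N hq₁I hq₁ω q₂ hq₂N hq₂I hq₂ω hsep hwz₁ hwz₂
      Q₁ Q₂' hQ₁ hQ₂'s hdisj'
  · exact exists_rerooting hN1 hω hy₂b hy₁b q₂ hq₂N hq₂I hq₂ω q₁ hq₁N hq₁I hq₁ω hsep' hwz₂ hwz₁
      Q₁ Q₂' hQ₁ hQ₂'s hdisj'

/-- **Four arms from radius `1` cost at most a constant more than four arms from the bond**:
`P(fourArmTwoClusters 1 N) ≤ 8^{|window|} · P(edgeFourArm [-N,N]² 0 0)` for `N ≥ 2`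
(Nolin 2008, §4.1, inner radius immaterial; Kesten 1987, §2). [folklore] -/
theorem real_fourArmTwoClusters_one_le {N : ℕ} (hN : 2 ≤ N) :
    (bondPercolation (zdGraph 2) half).real (fourArmTwoClusters 1 N) ≤
      8 ^ edgesNearOrigin.card *
        (bondPercolation (zdGraph 2) half).real (edgeFourArm (↑(box 2 N) : Set (Site 2)) 0 0) := by
  have key := bondPercolation_real_le_of_localModification (zdGraph 2) half edgesNearOrigin
    edgesNearOrigin_subset_edgeSet (A := fourArmTwoClusters 1 N) (measurableSet_edgeFourArm_box N 0 0)
    (fun ω hA hω => exists_rerooting_of_mem_fourArmTwoClusters_one hN hω hA)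
  rw [coe_half] at key
  have h4 : ((1 / 2 : ℝ) * (1 - 1 / 2)) ^ edgesNearOrigin.card * 4 ^ edgesNearOrigin.card = 1 := by
    rw [← mul_pow]; norm_num
  have h8 : (8 : ℝ) ^ edgesNearOrigin.card = 4 ^ edgesNearOrigin.card * 2 ^ edgesNearOrigin.card := by
    rw [← mul_pow]; norm_num
  calc (bondPercolation (zdGraph 2) half).real (fourArmTwoClusters 1 N)
      = 4 ^ edgesNearOrigin.card * (((1 / 2 : ℝ) * (1 - 1 / 2)) ^ edgesNearOrigin.card *
          (bondPercolation (zdGraph 2) half).real (fourArmTwoClusters 1 N)) := by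
        rw [← mul_assoc, mul_comm ((4 : ℝ) ^ _), h4, one_mul]
    _ ≤ 4 ^ edgesNearOrigin.card * (2 ^ edgesNearOrigin.card *
          (bondPercolation (zdGraph 2) half).real (edgeFourArm (↑(box 2 N) : Set (Site 2)) 0 0)) :=
        mul_le_mul_of_nonneg_left key (by positivity)
    _ = _ := by rw [h8]; ring

/-! ### The reduction -/

/-- **Quasi-multiplicativity from a single bond reduces to quasi-multiplicativity of annuli.**
`DuminilCopinManolescuTassion2021_zdFourArm_quasiMult → Nolin2008_zdEdgeFourArmQuasiMult`:
with `K = 8^{|window|}` and the annulus constant `C`, for `2 ≤ m < N`,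
`P(edgeFourArm [-m,m]²) · P(fourArmTwoClusters m N) ≤ P(fourArmTwoClusters 1 m) ·
P(fourArmTwoClusters m N) ≤ C · P(fourArmTwoClusters 1 N) ≤ C K · P(edgeFourArm [-N,N]²)`
(Nolin 2008, §4.1 with Prop. 17 [arXiv Prop. 16]; Kesten 1987, §2). [cite: Nolin2008, §4.1 and Prop. 17 (arXiv 0711.4948: Prop. 16)] -/
theorem Nolin2008_zdEdgeFourArmQuasiMult_of_zdFourArm_quasiMult
    (h : DuminilCopinManolescuTassion2021_zdFourArm_quasiMult) : Nolin2008_zdEdgeFourArmQuasiMult := by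
  obtain ⟨C, hC, hQ⟩ := h
  set K : ℝ := 8 ^ edgesNearOrigin.card with hK
  have hK0 : 0 < K := by positivity
  refine ⟨2, 1 / (C * K), by positivity, fun m N hm hmN => ?_⟩
  set P := bondPercolation (zdGraph 2) half with hP
  have h1 := real_edgeFourArm_box_le_real_fourArmTwoClusters_one (m := m) (by omega)
  have h2 := hQ 1 m N le_rfl (by omega) hmN.le
  have h3 := real_fourArmTwoClusters_one_le (N := N) (by omega)
  rw [one_div, inv_mul_le_iff₀ (by positivity)]
  calc P.real (edgeFourArm (↑(box 2 m) : Set (Site 2)) 0 0) * P.real (fourArmTwoClusters m N)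
      ≤ P.real (fourArmTwoClusters 1 m) * P.real (fourArmTwoClusters m N) :=
        mul_le_mul_of_nonneg_right h1 measureReal_nonneg
    _ ≤ C * P.real (fourArmTwoClusters 1 N) := h2
    _ ≤ C * (K * P.real (edgeFourArm (↑(box 2 N) : Set (Site 2)) 0 0)) :=
        mul_le_mul_of_nonneg_left h3 hC.le
    _ = C * K * P.real (edgeFourArm (↑(box 2 N) : Set (Site 2)) 0 0) := by ring

end Literature.Probability.Percolation
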